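import Summits.NavierStokesRegularity.FunctionalMining.NoGo.TopEigHeatTranslationAverage
import HarnessLib

/-!
# NO-GO K43 — INDEPENDENT SIGN SYMMETRIES: a superposition `u + ∑ⱼ wⱼ` of Laplace eigenfields whose
# high pieces can be FLIPPED ONE AT A TIME by translations fixing everything else is heat-coercive at the
# LOW-SHELL rate `q·c₁` (door (c), node K6, Lemma L-λ(q); static heat line `v + tΔv`, no transport, no pressure)

search for candidate a priori estimates; no regularity claim.

Cell `pub-nsfunc` (NS FUNCTIONAL MINING), NOGO seat (gen 50). A class-level structural statement about the
WITNESS SET of the wanted kill (F2) `¬ TopEigHeatCoercivePos q` of the heat-coercivity lemma L-λ(q)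
(`@[conjecture] TopEig.TopEigHeatCoercivePos q`; the tree's `heatDissipation`, `HeatCoerciveOn`). Nothing
about Navier–Stokes is proved or asserted; no node of the cell is decided (L-λ(q) stays OPEN in the kernel
for every real `q > 1`, FALSE at `q = 1`: K32 `NoGo/TopEigHeatCoerciveOne`).

SETTING (any finite `d`, every real `q ≥ 1`, both one-sided cores `Φ_q ∈ {∫(λ₁⁺)^q, ∫((−λ₃)⁺)^q}`).
`v = u + ∑_{j ∈ s} wⱼ` with `u, wⱼ` smooth, `Δu = −c₁u`, `Δwⱼ = −cⱼwⱼ`, `c₁ < cⱼ` (finitely many high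
pieces; a piece may be a whole Laplace shell or any part of one), and for every `j` a translation `hⱼ` with
  `u(· + hⱼ) = u`,  `wᵢ(· + hⱼ) = wᵢ (i ≠ j)`,  `wⱼ(· + hⱼ) = −wⱼ`     (INDEPENDENT SIGN SYMMETRIES).
THEOREM (`signSymmetricShells_coercive`, class form `heatCoerciveOn_signSymmetricShells_top/negBot`):
  **`q c₁ Φ_q(v) ≤ heatDissipation Φ_q v`** — the field is coercive at the full LOW-SHELL rate, hence is
  NOT a kill witness for L-λ(q) at any rate `c ≤ q c₁` (`signSymmetricShells_not_kill`).
PROOF (kernel, short). (1) BOX LEMMA (`signBox_le`): `Φ_q(u + ∑ⱼ σⱼwⱼ) ≤ Φ_q(u + ∑ⱼ wⱼ)` whenever all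
`|σⱼ| ≤ 1` — by induction on the pieces: along each piece the slice `τ ↦ Φ_q(X + τwⱼ)` (`X` = the rest) is
CONVEX (tree `TopEig.convexOn_topEigMoment_line`) and EVEN (translate by `hⱼ`: `Φ_q` is translation
invariant, K42 `torusTopEigMoment_translate`, `X` is fixed and `wⱼ` flips), so it is maximal at `τ = ±1` on
`[−1, 1]`. (2) K39's heat-line shift inequality (`TopEig.heatDissipation_topEigMoment_shift_ge`, with
`Δv = −c₁v − z`, `z = ∑ⱼ (cⱼ − c₁)wⱼ`): `q c₁ Φ_q(v) + (Φ_q(v) − Φ_q(v − τz))/τ ≤ heatDissipation Φ_q v` for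
every `τ > 0`; and `v − τz = u + ∑ⱼ (1 − τ(cⱼ − c₁))wⱼ` lies in the box for `τ` small, so the bracket is
`≥ 0` by (1).
MEANING (instruction (i)/(iii): a typed DESIGN RULE for door-(c)/(F2) candidates, sharpening K42's two-shell
rule to any number of pieces). The motivating instance is the CYCLIC KOLMOGOROV TRIPLE on `T³`,
`v = (a sin 2πm₁x₃ + …, b sin 2πm₂x₁ + …, e sin 2πm₃x₂ + …)` (one spatial frequency `mⱼ` per component,
any amplitudes and phases): it is divergence free, GENUINELY THREE-DIMENSIONAL (`det S = ¼ f′g′h′ ≢ 0`, with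
biaxial points `λ₂ = λ₁` where `f′g′h′ < 0` with equal moduli — so it passes the necessary condition for a
kill at `q ≥ 2` recorded in the tree, `TopEigGapCoerciveHigh`'s
`violators_outside_every_gap_of_not_pos_of_ge_two`), and yet the coordinate half-period shifts (by `1/(2m₂)`
along `x₁` for the second component, etc.; the lowest-frequency components form `u`) flip exactly one piece
each and fix the rest: by this file the triple is coercive at `q·4π²·min mⱼ²` for every real `q ≥ 1` and can
never refute L-λ(q) below that rate. «Genuinely 3-D» is necessary for a kill but far from sufficient: the
interference that lowers `Φ_q` must survive EVERY partial sign symmetry, which forces several commensurate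
frequencies INSIDE one piece that no translation separates (pen rider, lattice form, single-frequency pieces
`±kⱼ` over a low part with frequency set `K`: `hⱼ` exists iff `kⱼ ∉ span_ℤ(K ∪ {kᵢ : i ≠ j} ∪ {2kⱼ})`, because
`ℝ/ℤ` is divisible).
[ours; ingredients: tree line convexity, K39 shift inequality, K42 translation invariance]
search for candidate a priori estimates; no regularity claim.
FILING (prove seat g29, REQUEST #68): declarations byte-identical to the no-go seat's staged `TopEigHeatSignSymmetricShells.STAGING.lean` 9afc489cf8d0f279; this line is the only addition.
-/

noncomputable section

open MeasureTheory Set Filter Topology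

namespace Summit.NavierStokesRegularity.FunctionalMining

open Literature.Analysis.FunctionSpaces Literature.Analysis.FluidPDE

namespace TopEig

variable {d : Type*} [Fintype d]

/-! ## 1. Even convex slices and the box lemma (generic translation-invariant line-convex `Φ`) -/

section Generic

variable (Φ : (UnitAddTorus d → EuclideanSpace ℝ d) → ℝ)

omit [Fintype d] in
/-- A convex even slice is maximal at the endpoints: if `τ ↦ Φ(X + τ•w)` is convex on `ℝ` and
`Φ(X − w) = Φ(X + w)`, then `Φ(X + σ•w) ≤ Φ(X + w)` for `|σ| ≤ 1`. [bookkeeping] -/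
private theorem slice_le_of_even {X w : UnitAddTorus d → EuclideanSpace ℝ d}
    (hconv : ConvexOn ℝ univ (fun τ : ℝ => Φ (X + τ • w)))
    (heven : Φ (X + (-1 : ℝ) • w) = Φ (X + (1 : ℝ) • w)) {σ : ℝ} (hσ : |σ| ≤ 1) :
    Φ (X + σ • w) ≤ Φ (X + w) := by
  have ha : 0 ≤ (1 + σ) / 2 := by linarith [(abs_le.mp hσ).1]
  have hb : 0 ≤ (1 - σ) / 2 := by linarith [(abs_le.mp hσ).2]
  have hab : (1 + σ) / 2 + (1 - σ) / 2 = 1 := by ring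
  have key := hconv.2 (mem_univ (1 : ℝ)) (mem_univ (-1 : ℝ)) ha hb hab
  dsimp only at key
  have e : ((1 + σ) / 2) • (1 : ℝ) + ((1 - σ) / 2) • (-1 : ℝ) = σ := by
    simp only [smul_eq_mul]; ring
  rw [e, heven, one_smul] at key
  simp only [smul_eq_mul] at key
  have e2 : (1 + σ) / 2 * Φ (X + w) + (1 - σ) / 2 * Φ (X + w) = Φ (X + w) := by ring
  linarith

omit [Fintype d] in
/-- Evenness of a slice from a flip symmetry: if `Φ` is translation invariant, `X(· + h) = X` and
`w(· + h) = −w`, then `Φ(X + (−τ)•w) = Φ(X + τ•w)`. [bookkeeping] -/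
private theorem slice_even_of_flip
    (htrans : ∀ (v : UnitAddTorus d → EuclideanSpace ℝ d) (a : UnitAddTorus d),
      Φ (fun y => v (y + a)) = Φ v)
    {X w : UnitAddTorus d → EuclideanSpace ℝ d} (h : UnitAddTorus d)
    (hX : (fun y => X (y + h)) = X) (hw : (fun y => w (y + h)) = -w) (τ : ℝ) :
    Φ (X + (-τ) • w) = Φ (X + τ • w) := by
  rw [← htrans (X + τ • w) h]
  congr 1
  funext y
  have h1 := congrFun hX y
  have h2 := congrFun hw y
  simp only [Pi.add_apply, Pi.smul_apply, Pi.neg_apply] at h1 h2 ⊢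
  rw [h1, h2, smul_neg, neg_smul]

/-- A finite sum of smooth fields is smooth. [bookkeeping] -/
private theorem isSmooth_sum_fields {ι : Type*} (s : Finset ι)
    {w : ι → UnitAddTorus d → EuclideanSpace ℝ d} (hw : ∀ j ∈ s, Torus.IsSmooth (w j)) :
    Torus.IsSmooth (∑ j ∈ s, w j) := by
  classical
  induction s using Finset.induction_on with
  | empty =>
    rw [Finset.sum_empty]
    exact Torus.isSmooth_const (0 : EuclideanSpace ℝ d)
  | insert j s hj ih =>
    rw [Finset.sum_insert hj]
    exact (hw j (Finset.mem_insert_self j s)).add (ih fun i hi => hw i (Finset.mem_insert_of_mem hi))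

/-- **THE BOX LEMMA.** Let `Φ` be translation invariant and convex along smooth lines. If the smooth pieces
`wⱼ` (`j ∈ s`) carry INDEPENDENT SIGN SYMMETRIES — translations `hⱼ` with `wᵢ(· + hⱼ) = wᵢ` (`i ≠ j`),
`wⱼ(· + hⱼ) = −wⱼ` — then for every smooth `u` fixed by all `hⱼ` and all `|σⱼ| ≤ 1`:
`Φ(u + ∑ⱼ σⱼwⱼ) ≤ Φ(u + ∑ⱼ wⱼ)`. [ours, calibration] -/
theorem signBox_le
    (hline : ∀ {v w : UnitAddTorus d → EuclideanSpace ℝ d}, Torus.IsSmooth v → Torus.IsSmooth w →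
      ConvexOn ℝ univ (fun t : ℝ => Φ (v + t • w)))
    (htrans : ∀ (v : UnitAddTorus d → EuclideanSpace ℝ d) (a : UnitAddTorus d),
      Φ (fun y => v (y + a)) = Φ v)
    {ι : Type*} {w : ι → UnitAddTorus d → EuclideanSpace ℝ d} {h : ι → UnitAddTorus d} {σ : ι → ℝ}
    (s : Finset ι) (hw : ∀ j ∈ s, Torus.IsSmooth (w j))
    (hfix : ∀ j ∈ s, ∀ i ∈ s, i ≠ j → (fun y => w i (y + h j)) = w i)
    (hflip : ∀ j ∈ s, (fun y => w j (y + h j)) = -w j) (hσ : ∀ j ∈ s, |σ j| ≤ 1) :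
    ∀ u : UnitAddTorus d → EuclideanSpace ℝ d, Torus.IsSmooth u →
      (∀ j ∈ s, (fun y => u (y + h j)) = u) → Φ (u + ∑ j ∈ s, σ j • w j) ≤ Φ (u + ∑ j ∈ s, w j) := by
  classical
  induction s using Finset.induction_on with
  | empty =>
    intro u _ _
    simp only [Finset.sum_empty, le_refl]
  | insert j s hj ih =>
    intro u hu hfu
    have hjs : j ∈ insert j s := Finset.mem_insert_self j s
    have hw' : ∀ i ∈ s, Torus.IsSmooth (w i) := fun i hi => hw i (Finset.mem_insert_of_mem hi)
    have ih' := ih hw'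
      (fun j' hj' i hi hne => hfix j' (Finset.mem_insert_of_mem hj') i (Finset.mem_insert_of_mem hi) hne)
      (fun i hi => hflip i (Finset.mem_insert_of_mem hi)) (fun i hi => hσ i (Finset.mem_insert_of_mem hi))
    have hwj : Torus.IsSmooth (w j) := hw j hjs
    -- step 1: the induction hypothesis with base point `u + σⱼ • wⱼ`
    have hb : Torus.IsSmooth (u + σ j • w j) := hu.add (Torus.IsSmooth.smul _ hwj)
    have hbfix : ∀ i ∈ s, (fun y => (u + σ j • w j) (y + h i)) = u + σ j • w j := by
      intro i hi
      have hne : j ≠ i := fun e => hj (e ▸ hi)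
      have e1 := hfu i (Finset.mem_insert_of_mem hi)
      have e2 := hfix i (Finset.mem_insert_of_mem hi) j hjs hne
      funext y
      have f1 := congrFun e1 y
      have f2 := congrFun e2 y
      simp only [Pi.add_apply, Pi.smul_apply] at f1 f2 ⊢
      rw [f1, f2]
    have step1 := ih' (u + σ j • w j) hb hbfix
    -- step 2: the even convex slice in the direction `wⱼ` at `X = u + ∑_{i ∈ s} wᵢ`
    have hX : Torus.IsSmooth (u + ∑ i ∈ s, w i) := hu.add (isSmooth_sum_fields s hw')
    have hXfix : (fun y => (u + ∑ i ∈ s, w i) (y + h j)) = u + ∑ i ∈ s, w i := by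
      have e1 := hfu j hjs
      funext y
      have f1 := congrFun e1 y
      simp only [Pi.add_apply, Finset.sum_apply] at f1 ⊢
      rw [f1]
      congr 1
      refine Finset.sum_congr rfl fun i hi => ?_
      have hne : i ≠ j := fun e => hj (e ▸ hi)
      exact congrFun (hfix j hjs i (Finset.mem_insert_of_mem hi) hne) y
    have step2 := slice_le_of_even Φ (hline hX hwj)
      (slice_even_of_flip Φ htrans (h j) hXfix (hflip j hjs) 1) (hσ j hjs)
    rw [Finset.sum_insert hj, Finset.sum_insert hj]
    calc Φ (u + (σ j • w j + ∑ i ∈ s, σ i • w i))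
        = Φ ((u + σ j • w j) + ∑ i ∈ s, σ i • w i) := by rw [add_assoc]
      _ ≤ Φ ((u + σ j • w j) + ∑ i ∈ s, w i) := step1
      _ = Φ ((u + ∑ i ∈ s, w i) + σ j • w j) := by congr 1; abel
      _ ≤ Φ ((u + ∑ i ∈ s, w i) + w j) := step2
      _ = Φ (u + (w j + ∑ i ∈ s, w i)) := by congr 1; abel

end Generic

/-! ## 2. The multi-shell Laplacian and the coercivity theorem -/

section Shells

variable [DecidableEq d] {q : ℝ}

omit [DecidableEq d] in
/-- `Δ(u + ∑ⱼ wⱼ) = −c₁(u + ∑ⱼ wⱼ) − ∑ⱼ (cⱼ − c₁)wⱼ` for Laplace eigenfields `Δu = −c₁u`, `Δwⱼ = −cⱼwⱼ`.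
[bookkeeping] -/
private theorem laplacian_shells {ι : Type*} (s : Finset ι)
    {u : UnitAddTorus d → EuclideanSpace ℝ d} {w : ι → UnitAddTorus d → EuclideanSpace ℝ d}
    {c₁ : ℝ} {c : ι → ℝ} (hu : Torus.IsSmooth u) (hw : ∀ j ∈ s, Torus.IsSmooth (w j))
    (hΔu : Torus.laplacian u = -(c₁ • u)) (hΔw : ∀ j ∈ s, Torus.laplacian (w j) = -(c j • w j)) :
    Torus.laplacian (u + ∑ j ∈ s, w j) =
      -(c₁ • (u + ∑ j ∈ s, w j)) - ∑ j ∈ s, (c j - c₁) • w j := by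
  classical
  induction s using Finset.induction_on with
  | empty => simpa using hΔu
  | insert j s hj ih =>
    have hjs : j ∈ insert j s := Finset.mem_insert_self j s
    have hw' : ∀ i ∈ s, Torus.IsSmooth (w i) := fun i hi => hw i (Finset.mem_insert_of_mem hi)
    have ih' := ih hw' (fun i hi => hΔw i (Finset.mem_insert_of_mem hi))
    have hS : Torus.IsSmooth (u + ∑ i ∈ s, w i) := hu.add (isSmooth_sum_fields s hw')
    have e1 : u + ∑ i ∈ insert j s, w i = (u + ∑ i ∈ s, w i) + w j := by
      rw [Finset.sum_insert hj]; abel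
    rw [e1]
    funext x
    rw [Literature.Analysis.FunctionSpaces.Torus.laplacian_add_apply hS (hw j hjs), congrFun ih' x, congrFun (hΔw j hjs) x,
      Finset.sum_insert hj]
    simp only [Pi.add_apply, Pi.sub_apply, Pi.neg_apply, Pi.smul_apply, Finset.sum_apply]
    module

omit [DecidableEq d] in
/-- The abstract coercivity argument, for a translation-invariant line-convex `Φ` obeying K39's heat-line
shift inequality. [ours, calibration] -/
private theorem shells_coercive_of (Φ : (UnitAddTorus d → EuclideanSpace ℝ d) → ℝ) {c₀ : ℝ}
    (hline : ∀ {v w : UnitAddTorus d → EuclideanSpace ℝ d}, Torus.IsSmooth v → Torus.IsSmooth w →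
      ConvexOn ℝ univ (fun t : ℝ => Φ (v + t • w)))
    (htrans : ∀ (v : UnitAddTorus d → EuclideanSpace ℝ d) (a : UnitAddTorus d),
      Φ (fun y => v (y + a)) = Φ v)
    (hshift : ∀ {v z : UnitAddTorus d → EuclideanSpace ℝ d} {c₁ τ : ℝ}, Torus.IsSmooth v →
      Torus.IsSmooth z → Torus.laplacian v = -(c₁ • v) - z → 0 < τ →
      c₀ * c₁ * Φ v + (Φ v - Φ (v + τ • (-z))) / τ ≤ heatDissipation Φ v)
    {ι : Type*} (s : Finset ι) {u : UnitAddTorus d → EuclideanSpace ℝ d}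
    {w : ι → UnitAddTorus d → EuclideanSpace ℝ d} {c₁ : ℝ} {c : ι → ℝ} {h : ι → UnitAddTorus d}
    (hu : Torus.IsSmooth u) (hw : ∀ j ∈ s, Torus.IsSmooth (w j))
    (hΔu : Torus.laplacian u = -(c₁ • u)) (hΔw : ∀ j ∈ s, Torus.laplacian (w j) = -(c j • w j))
    (hc : ∀ j ∈ s, c₁ < c j) (hfu : ∀ j ∈ s, (fun y => u (y + h j)) = u)
    (hfix : ∀ j ∈ s, ∀ i ∈ s, i ≠ j → (fun y => w i (y + h j)) = w i)
    (hflip : ∀ j ∈ s, (fun y => w j (y + h j)) = -w j) :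
    c₀ * c₁ * Φ (u + ∑ j ∈ s, w j) ≤ heatDissipation Φ (u + ∑ j ∈ s, w j) := by
  obtain ⟨C, hC⟩ := (s.image c).bddAbove
  have hCj : ∀ j ∈ s, c j ≤ C := fun j hj => hC (Finset.mem_coe.mpr (Finset.mem_image_of_mem c hj))
  have hD : 0 < |C - c₁| + 1 := by positivity
  set τ : ℝ := 2 / (|C - c₁| + 1) with hτ_def
  have hτ : 0 < τ := by positivity
  have hbox : ∀ j ∈ s, |1 - τ * (c j - c₁)| ≤ 1 := by
    intro j hj
    have h0 : 0 < c j - c₁ := sub_pos.mpr (hc j hj)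
    have h1 : c j - c₁ ≤ |C - c₁| + 1 := by linarith [hCj j hj, le_abs_self (C - c₁)]
    have h2 : τ * (c j - c₁) = 2 * ((c j - c₁) / (|C - c₁| + 1)) := by rw [hτ_def]; ring
    have h3 : (c j - c₁) / (|C - c₁| + 1) ≤ 1 := (div_le_one hD).mpr h1
    have h4 : 0 ≤ (c j - c₁) / (|C - c₁| + 1) := div_nonneg h0.le hD.le
    rw [abs_le]
    constructor <;> nlinarith
  have hz : Torus.IsSmooth (∑ j ∈ s, (c j - c₁) • w j) :=
    isSmooth_sum_fields s fun j hj => Torus.IsSmooth.smul _ (hw j hj)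
  have hv : Torus.IsSmooth (u + ∑ j ∈ s, w j) := hu.add (isSmooth_sum_fields s hw)
  have key := hshift hv hz (laplacian_shells s hu hw hΔu hΔw) hτ
  have e : u + ∑ j ∈ s, w j + τ • (-∑ j ∈ s, (c j - c₁) • w j) =
      u + ∑ j ∈ s, (1 - τ * (c j - c₁)) • w j := by
    rw [add_assoc, smul_neg, Finset.smul_sum, ← sub_eq_add_neg, ← Finset.sum_sub_distrib]
    congr 1
    refine Finset.sum_congr rfl fun j _ => ?_
    module
  have box := signBox_le Φ hline htrans s hw hfix hflip hbox u hu hfu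
  rw [← e] at box
  have hnn : 0 ≤ (Φ (u + ∑ j ∈ s, w j) - Φ (u + ∑ j ∈ s, w j + τ • (-∑ j ∈ s, (c j - c₁) • w j))) / τ :=
    div_nonneg (by linarith) hτ.le
  linarith

variable [Nonempty d]

/-- **INDEPENDENT SIGN SYMMETRIES ⇒ COERCIVE AT THE LOW-SHELL RATE (both cores).** `q ≥ 1`; `u, wⱼ` smooth,
`Δu = −c₁u`, `Δwⱼ = −cⱼwⱼ`, `c₁ < cⱼ` (`j ∈ s`); translations `hⱼ` with `u(· + hⱼ) = u`,
`wᵢ(· + hⱼ) = wᵢ (i ≠ j)`, `wⱼ(· + hⱼ) = −wⱼ`. Then for `v = u + ∑ⱼ wⱼ` and `Φ_q ∈ {∫(λ₁⁺)^q, ∫((−λ₃)⁺)^q}`: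
`q c₁ Φ_q(v) ≤ heatDissipation Φ_q v`. [ours, calibration] -/
theorem signSymmetricShells_coercive (hq : 1 ≤ q) {ι : Type*} (s : Finset ι)
    {u : UnitAddTorus d → EuclideanSpace ℝ d} {w : ι → UnitAddTorus d → EuclideanSpace ℝ d} {c₁ : ℝ}
    {c : ι → ℝ} {h : ι → UnitAddTorus d} (hu : Torus.IsSmooth u) (hw : ∀ j ∈ s, Torus.IsSmooth (w j))
    (hΔu : Torus.laplacian u = -(c₁ • u)) (hΔw : ∀ j ∈ s, Torus.laplacian (w j) = -(c j • w j))
    (hc : ∀ j ∈ s, c₁ < c j) (hfu : ∀ j ∈ s, (fun y => u (y + h j)) = u)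
    (hfix : ∀ j ∈ s, ∀ i ∈ s, i ≠ j → (fun y => w i (y + h j)) = w i)
    (hflip : ∀ j ∈ s, (fun y => w j (y + h j)) = -w j) :
    q * c₁ * torusTopEigMoment q (u + ∑ j ∈ s, w j) ≤
        heatDissipation (torusTopEigMoment q) (u + ∑ j ∈ s, w j) ∧
      q * c₁ * torusNegBotEigMoment q (u + ∑ j ∈ s, w j) ≤
        heatDissipation (torusNegBotEigMoment q) (u + ∑ j ∈ s, w j) :=
  ⟨shells_coercive_of (torusTopEigMoment q) (fun hv hw' => convexOn_topEigMoment_line hq hv hw')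
      (torusTopEigMoment_translate q) (fun hv hz hΔ hτ => heatDissipation_topEigMoment_shift_ge hq hv hz hΔ hτ)
      s hu hw hΔu hΔw hc hfu hfix hflip,
    shells_coercive_of (torusNegBotEigMoment q) (fun hv hw' => convexOn_negBotEigMoment_line hq hv hw')
      (torusNegBotEigMoment_translate q)
      (fun hv hz hΔ hτ => heatDissipation_negBotEigMoment_shift_ge hq hv hz hΔ hτ)
      s hu hw hΔu hΔw hc hfu hfix hflip⟩

/-- **NO KILL FROM A SIGN-SYMMETRIC SUPERPOSITION (both cores)**: under the hypotheses of
`signSymmetricShells_coercive`, `u + ∑ⱼ wⱼ` is not a kill witness for L-λ(q) at any rate `c' ≤ q c₁`.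
[ours, calibration] -/
theorem signSymmetricShells_not_kill (hq : 1 ≤ q) {ι : Type*} (s : Finset ι)
    {u : UnitAddTorus d → EuclideanSpace ℝ d} {w : ι → UnitAddTorus d → EuclideanSpace ℝ d} {c₁ : ℝ}
    {c : ι → ℝ} {h : ι → UnitAddTorus d} (hu : Torus.IsSmooth u) (hw : ∀ j ∈ s, Torus.IsSmooth (w j))
    (hΔu : Torus.laplacian u = -(c₁ • u)) (hΔw : ∀ j ∈ s, Torus.laplacian (w j) = -(c j • w j))
    (hc : ∀ j ∈ s, c₁ < c j) (hfu : ∀ j ∈ s, (fun y => u (y + h j)) = u)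
    (hfix : ∀ j ∈ s, ∀ i ∈ s, i ≠ j → (fun y => w i (y + h j)) = w i)
    (hflip : ∀ j ∈ s, (fun y => w j (y + h j)) = -w j) {c' : ℝ} (hc' : c' ≤ q * c₁) :
    ¬ heatDissipation (torusTopEigMoment q) (u + ∑ j ∈ s, w j) <
        c' * torusTopEigMoment q (u + ∑ j ∈ s, w j) ∧
      ¬ heatDissipation (torusNegBotEigMoment q) (u + ∑ j ∈ s, w j) <
        c' * torusNegBotEigMoment q (u + ∑ j ∈ s, w j) := by
  obtain ⟨h1, h2⟩ := signSymmetricShells_coercive hq s hu hw hΔu hΔw hc hfu hfix hflip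
  have p1 := torusTopEigMoment_nonneg q (u + ∑ j ∈ s, w j)
  have p2 := torusNegBotEigMoment_nonneg q (u + ∑ j ∈ s, w j)
  exact ⟨fun hlt => by nlinarith, fun hlt => by nlinarith⟩

/-- **THE TWO-SHELL CASE RECOVERED** (K42 `twoShell_coercive_of_halfPeriod`, as the one-piece instance
`s = {0}` of the box): recorded as a consistency check of the hypotheses' shape. [ours, calibration] -/
example (hq : 1 ≤ q) {u w₀ : UnitAddTorus d → EuclideanSpace ℝ d} {c₁ c₂ : ℝ} (h12 : c₁ < c₂)
    (hu : Torus.IsSmooth u) (hw : Torus.IsSmooth w₀) (hΔu : Torus.laplacian u = -(c₁ • u))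
    (hΔw : Torus.laplacian w₀ = -(c₂ • w₀)) (h₀ : UnitAddTorus d) (hper : (fun y => u (y + h₀)) = u)
    (hanti : (fun y => w₀ (y + h₀)) = -w₀) :
    q * c₁ * torusTopEigMoment q (u + w₀) ≤ heatDissipation (torusTopEigMoment q) (u + w₀) := by
  have key := (signSymmetricShells_coercive hq (Finset.univ : Finset (Fin 1)) (w := fun _ => w₀)
    (c := fun _ => c₂) (h := fun _ => h₀) hu (fun _ _ => hw) hΔu (fun _ _ => hΔw) (fun _ _ => h12)
    (fun _ _ => hper) (fun j _ i _ hne => absurd (Subsingleton.elim i j) hne) (fun _ _ => hanti)).1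
  simpa using key

end Shells

/-! ## 3. The class statements -/

/-- **The sign-symmetric multi-shell class is heat-coercive at the low-shell rate (`λ₁` core)**: for every
real `q ≥ 1` and `c₁`, `HeatCoerciveOn {u + ∑_{j<n} wⱼ : Δu = −c₁u, Δwⱼ = −cⱼwⱼ, c₁ < cⱼ, independent sign
symmetries hⱼ} (∫(λ₁⁺)^q) (q c₁)`. [ours, calibration] -/
theorem heatCoerciveOn_signSymmetricShells_top [DecidableEq d] [Nonempty d] {q : ℝ} (hq : 1 ≤ q)
    (c₁ : ℝ) :
    HeatCoerciveOn
      (fun v : UnitAddTorus d → EuclideanSpace ℝ d =>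
        ∃ (n : ℕ) (u : UnitAddTorus d → EuclideanSpace ℝ d) (w : Fin n → UnitAddTorus d → EuclideanSpace ℝ d)
          (c : Fin n → ℝ) (h : Fin n → UnitAddTorus d),
          Torus.IsSmooth u ∧ (∀ j, Torus.IsSmooth (w j)) ∧ Torus.laplacian u = -(c₁ • u) ∧
          (∀ j, Torus.laplacian (w j) = -(c j • w j)) ∧ (∀ j, c₁ < c j) ∧
          (∀ j, (fun y => u (y + h j)) = u) ∧ (∀ j i, i ≠ j → (fun y => w i (y + h j)) = w i) ∧
          (∀ j, (fun y => w j (y + h j)) = -w j) ∧ v = u + ∑ j, w j)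
      (torusTopEigMoment q) (q * c₁) := by
  rintro - v - - - ⟨n, u, w, c, h, hu, hw, hΔu, hΔw, hc, hfu, hfix, hflip, rfl⟩
  exact (signSymmetricShells_coercive hq Finset.univ hu (fun j _ => hw j) hΔu (fun j _ => hΔw j)
    (fun j _ => hc j) (fun j _ => hfu j) (fun j _ i _ hne => hfix j i hne) (fun j _ => hflip j)).1

/-- The same for the `−λ₃` core. [ours, calibration] -/
theorem heatCoerciveOn_signSymmetricShells_negBot [DecidableEq d] [Nonempty d] {q : ℝ} (hq : 1 ≤ q)
    (c₁ : ℝ) :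
    HeatCoerciveOn
      (fun v : UnitAddTorus d → EuclideanSpace ℝ d =>
        ∃ (n : ℕ) (u : UnitAddTorus d → EuclideanSpace ℝ d) (w : Fin n → UnitAddTorus d → EuclideanSpace ℝ d)
          (c : Fin n → ℝ) (h : Fin n → UnitAddTorus d),
          Torus.IsSmooth u ∧ (∀ j, Torus.IsSmooth (w j)) ∧ Torus.laplacian u = -(c₁ • u) ∧
          (∀ j, Torus.laplacian (w j) = -(c j • w j)) ∧ (∀ j, c₁ < c j) ∧
          (∀ j, (fun y => u (y + h j)) = u) ∧ (∀ j i, i ≠ j → (fun y => w i (y + h j)) = w i) ∧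
          (∀ j, (fun y => w j (y + h j)) = -w j) ∧ v = u + ∑ j, w j)
      (torusNegBotEigMoment q) (q * c₁) := by
  rintro - v - - - ⟨n, u, w, c, h, hu, hw, hΔu, hΔw, hc, hfu, hfix, hflip, rfl⟩
  exact (signSymmetricShells_coercive hq Finset.univ hu (fun j _ => hw j) hΔu (fun j _ => hΔw j)
    (fun j _ => hc j) (fun j _ => hfu j) (fun j _ i _ hne => hfix j i hne) (fun j _ => hflip j)).2

end TopEig

end Summit.NavierStokesRegularity.FunctionalMining

end
-- search for candidate a priori estimates; no regularity claim
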